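import Mathlib
import Literature.MathematicalPhysics.QuantumFieldTheory.Luscher2010.TrivializingMaps
import HarnessLib

/-!
# An orthonormal basis of `𝔰𝔲(n)` exists: `SuBasis n` is inhabited for every `n`

HONEST FRAMING: exact (Metropolis-corrected) sampling algorithms for lattice gauge theory; figures
of merit are autocorrelation/cost numbers at stated couplings and volumes; no continuum-physics claim.
Pure linear algebra; no lattice.

Lüscher 2010 [Luscher2010Trivializing], App. A.1 eqs. (A.1)–(A.2), fixes a basis `T^a` of `𝔰𝔲(n)` with
`tr(T^a T^b) = -½ δ^{ab}`; file A types such a basis as DATA (`SuBasis n`) and every theorem of the venture's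
Lüscher programme takes `(B : SuBasis n)` as a parameter (THEOREM A even case-splits on
`isEmpty_or_nonempty (SuBasis n)`).  This file CONSTRUCTS one for every `n` (`stdSuBasis n`), by
Gram–Schmidt (Mathlib's `stdOrthonormalBasis`) for the real inner product `⟪X, Y⟫ = -2 Re tr(XY)` on the real
vector space `𝔰𝔲(n)` (positive definite: `-2 Re tr(X²) = 2 ∑|X_{ij}|²` for skew-Hermitian `X`; `tr(XY)` is
real for skew-Hermitian `X, Y`), so that basis parameters can be discharged: `Nonempty (SuBasis n)`.
Authored by the pub-lqcd lean-2 seat (cell lqcd-flow, FANOUT row 31 GEN-4). Tags: [folklore].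
-/

noncomputable section

namespace Summit.Ventures.LatticeQCDFlow.TrivializingMaps

open scoped ComplexConjugate Matrix
open Literature.MathematicalPhysics.QuantumFieldTheory
open Literature.MathematicalPhysics.QuantumFieldTheory.Luscher2010

namespace SuBasisExistence

variable {n : ℕ}

/-! ## §1. Traces of products of skew-Hermitian matrices -/

/-- `tr(XY)` is real for skew-Hermitian `X, Y`: `conj tr(XY) = tr((XY)ᴴ) = tr(YᴴXᴴ) = tr(YX) = tr(XY)`.
[folklore] -/
theorem conj_trace_mul_eq {X Y : Matrix (Fin n) (Fin n) ℂ} (hX : Xᴴ = -X) (hY : Yᴴ = -Y) :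
    conj (X * Y).trace = (X * Y).trace := by
  rw [show conj (X * Y).trace = star (X * Y).trace from rfl, ← Matrix.trace_conjTranspose,
    Matrix.conjTranspose_mul, hX, hY, neg_mul_neg, Matrix.trace_mul_comm]

/-- Hence `tr(XY) = Re tr(XY)` for skew-Hermitian `X, Y`. [folklore] -/
theorem trace_mul_eq_re {X Y : Matrix (Fin n) (Fin n) ℂ} (hX : Xᴴ = -X) (hY : Yᴴ = -Y) :
    (X * Y).trace = (((X * Y).trace.re : ℝ) : ℂ) :=
  (Complex.conj_eq_iff_re.1 (conj_trace_mul_eq hX hY)).symm ▸ rfl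

/-- `-Re tr(X²) = ∑_{ij} |X_{ij}|²` for skew-Hermitian `X`. [folklore] -/
theorem neg_re_trace_mul_self {X : Matrix (Fin n) (Fin n) ℂ} (hX : Xᴴ = -X) :
    -(X * X).trace.re = ∑ i, ∑ j, Complex.normSq (X i j) := by
  have h1 : X * X = -(Xᴴ * X) := by rw [hX, neg_mul, neg_neg]
  rw [h1, Matrix.trace_neg, Complex.neg_re, neg_neg, Matrix.trace]
  simp only [Matrix.diag_apply, Matrix.mul_apply, Matrix.conjTranspose_apply, Complex.re_sum]
  rw [Finset.sum_comm]
  refine Finset.sum_congr rfl fun i _ => Finset.sum_congr rfl fun j _ => ?_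
  simp only [Complex.star_def, Complex.mul_re, Complex.conj_re, Complex.conj_im, Complex.normSq_apply]
  ring

/-! ## §2. The trace inner product on `𝔰𝔲(n)` -/

/-- `M_n(ℂ)` is finite-dimensional over `ℝ` (as the function space `Fin n → Fin n → ℂ`). [folklore] -/
instance instFiniteDimensionalMatrix : FiniteDimensional ℝ (Matrix (Fin n) (Fin n) ℂ) :=
  inferInstanceAs (FiniteDimensional ℝ (Fin n → Fin n → ℂ))

/-- The inner product `⟪X, Y⟫ = -2 Re tr(XY)` on `𝔰𝔲(n)` (App. A.1: `tr(T^aT^b) = -½δ^{ab}` says the `T^a`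
are orthonormal for it). [cite: Luscher2010Trivializing, App. A.1 eqs. (A.1)–(A.2)] -/
@[reducible] def innerCore : InnerProductSpace.Core ℝ (suAlgebra n) where
  inner X Y := -2 * ((X : Matrix (Fin n) (Fin n) ℂ) * (Y : Matrix (Fin n) (Fin n) ℂ)).trace.re
  conj_inner_symm X Y := by
    simp only [conj_trivial]
    rw [Matrix.trace_mul_comm]
  re_inner_nonneg X := by
    have hX := ((mem_suAlgebra_iff _).1 X.2).1
    simp only [RCLike.re_to_real]
    have h := neg_re_trace_mul_self hX
    have h0 : 0 ≤ ∑ i, ∑ j, Complex.normSq ((X : Matrix (Fin n) (Fin n) ℂ) i j) :=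
      Finset.sum_nonneg fun i _ => Finset.sum_nonneg fun j _ => Complex.normSq_nonneg _
    linarith
  add_left X Y Z := by
    simp only [Submodule.coe_add, add_mul, Matrix.trace_add, Complex.add_re]
    ring
  smul_left X Y r := by
    simp only [Submodule.coe_smul, Matrix.smul_mul, Matrix.trace_smul, conj_trivial,
      Complex.real_smul, Complex.re_ofReal_mul]
    ring
  definite X hX := by
    have hX' := ((mem_suAlgebra_iff _).1 X.2).1
    have h := neg_re_trace_mul_self hX'
    have hsum : ∑ i, ∑ j, Complex.normSq ((X : Matrix (Fin n) (Fin n) ℂ) i j) = 0 := by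
      change -2 * ((X : Matrix (Fin n) (Fin n) ℂ) * (X : Matrix (Fin n) (Fin n) ℂ)).trace.re = 0 at hX
      linarith
    have hent : ∀ i j, (X : Matrix (Fin n) (Fin n) ℂ) i j = 0 := by
      intro i j
      have hi := (Finset.sum_eq_zero_iff_of_nonneg fun i _ =>
        Finset.sum_nonneg fun j _ => Complex.normSq_nonneg _).1 hsum i (Finset.mem_univ i)
      have hij := (Finset.sum_eq_zero_iff_of_nonneg fun j _ => Complex.normSq_nonneg _).1 hi j
        (Finset.mem_univ j)
      exact Complex.normSq_eq_zero.1 hij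
    exact Subtype.ext (Matrix.ext fun i j => by rw [hent i j]; rfl)

/-- The normed group structure of the trace inner product (local). [folklore] -/
@[reducible] def instNormedAddCommGroup : NormedAddCommGroup (suAlgebra n) :=
  @InnerProductSpace.Core.toNormedAddCommGroup ℝ (suAlgebra n) _ _ _ innerCore

attribute [local instance] instNormedAddCommGroup

/-- The inner product space structure of the trace inner product (local). [folklore] -/
@[reducible] def instInnerProductSpace : InnerProductSpace ℝ (suAlgebra n) :=
  InnerProductSpace.ofCore _

attribute [local instance] instInnerProductSpace

/-- The inner product, unfolded. [folklore] -/
theorem inner_eq (X Y : suAlgebra n) :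
    inner ℝ X Y = -2 * ((X : Matrix (Fin n) (Fin n) ℂ) * (Y : Matrix (Fin n) (Fin n) ℂ)).trace.re := rfl

/-! ## §3. The standard `SuBasis` -/

/-- **An orthonormal basis of `𝔰𝔲(n)` in Lüscher's normalisation**, for every `n`: the Gram–Schmidt basis of
the trace inner product, repackaged as file A's `SuBasis n` (`tr(T^aT^b) = -½δ^{ab}`, spanning, `T^a ∈ 𝔰𝔲(n)`).
[cite: Luscher2010Trivializing, App. A.1 eqs. (A.1)–(A.2)] -/
def stdSuBasis (n : ℕ) : SuBasis n where
  ι := Fin (Module.finrank ℝ (suAlgebra n))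
  T a := ((stdOrthonormalBasis ℝ (suAlgebra n) a : suAlgebra n) : Matrix (Fin n) (Fin n) ℂ)
  mem a := (stdOrthonormalBasis ℝ (suAlgebra n) a).2
  orth a b := by
    set e := stdOrthonormalBasis ℝ (suAlgebra n) with he
    have hab : inner ℝ (e a) (e b) = if a = b then (1 : ℝ) else 0 := orthonormal_iff_ite.1 e.orthonormal a b
    rw [inner_eq] at hab
    have hX := ((mem_suAlgebra_iff _).1 (e a).2).1
    have hY := ((mem_suAlgebra_iff _).1 (e b).2).1
    rw [trace_mul_eq_re hX hY]
    split_ifs at hab with h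
    · rw [if_pos h]
      have : ((e a : Matrix (Fin n) (Fin n) ℂ) * (e b : Matrix (Fin n) (Fin n) ℂ)).trace.re = -(1 / 2) := by
        linarith
      rw [this]; push_cast; ring
    · rw [if_neg h]
      have : ((e a : Matrix (Fin n) (Fin n) ℂ) * (e b : Matrix (Fin n) (Fin n) ℂ)).trace.re = 0 := by
        linarith
      rw [this]; simp
  span X hX := by
    set e := stdOrthonormalBasis ℝ (suAlgebra n) with he
    refine ⟨fun a => inner ℝ (e a) (⟨X, hX⟩ : suAlgebra n), ?_⟩
    have h := e.sum_repr' (⟨X, hX⟩ : suAlgebra n)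
    have h' := congrArg (fun v : suAlgebra n => (v : Matrix (Fin n) (Fin n) ℂ)) h
    simp only [Submodule.coe_sum, Submodule.coe_smul] at h'
    exact h'.symm.trans (Finset.sum_congr rfl fun a _ => by rw [Complex.coe_smul])

end SuBasisExistence

/-- **`SuBasis n` is inhabited for every `n`.** [folklore] -/
instance nonempty_suBasis (n : ℕ) : Nonempty (SuBasis n) := ⟨SuBasisExistence.stdSuBasis n⟩

end Summit.Ventures.LatticeQCDFlow.TrivializingMaps

end
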